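import Mathlib
import HarnessLib

/-!
# ζ(5) search — kernel-checked finite-field lemmas behind the excess-window theorem (cell `pub-zeta5`, gen-2 g5; STAGED)

HONEST FRAMING: systematic search; no irrationality claim unless certified.

These are the two elementary 𝔽_p facts used in the paper proof of the big-prime divisibility theorem (W∞)
(REPORT-gen2-g5 §5f): the power-sum lemma in "s-th derivative" form — `Σ_{x ∈ 𝔽_p} (P^{(s)})(x) = 0` for every
polynomial `P` of degree `< s + (s+1)(p−1)` — and the Wilson-type product `∏_{a ≠ 0} (X + a) = X^{p−1} − 1` in `𝔽_p[X]`
that turns a reciprocal Pochhammer block into the complementary polynomial block at every pole.  Staged for the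
typer/prover who formalises §5f; nothing here mentions the series.
-/

namespace Summit.KontsevichZagierPeriods.Zeta5Search.ExcessWindow

open Polynomial Finset

/-- Power sums over `ZMod p` including `x = 0`: for `e ≠ 0`, `Σ_x x^e = −1` if `(p−1) ∣ e` and `0` otherwise. -/
theorem sum_pow_zmod_eq (p : ℕ) [hp : Fact p.Prime] (e : ℕ) (he : e ≠ 0) :
    ∑ x : ZMod p, x ^ e = if p - 1 ∣ e then -1 else 0 := by
  classical
  have h := FiniteField.sum_pow_units (ZMod p) e
  rw [ZMod.card] at h
  have hsplit : ∑ x : ZMod p, x ^ e = ∑ u : (ZMod p)ˣ, ((u : ZMod p) ^ e) := by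
    rw [← Finset.sum_sdiff ({0} : Finset (ZMod p)).subset_univ, Finset.sum_singleton,
      zero_pow he, add_zero]
    refine Finset.sum_bij' (fun x hx => Units.mk0 x (by simpa using hx)) (fun u _ => (u : ZMod p))
      ?_ ?_ ?_ ?_ ?_
    · intro x hx; simp
    · intro u hu; simp
    · intro x hx; simp
    · intro u hu; simp
    · intro x hx; simp
  rw [hsplit]
  simpa [Units.val_pow_eq_pow_val] using h

/-- `Σ_{x ∈ 𝔽_p} (X^m)^{(s)}(x) = 0` whenever `m < s + (s+1)(p−1)`: either the exponent `m − s` is not a positive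
multiple of `p − 1`, or it is `l(p−1)` with `1 ≤ l ≤ s` and then `p` divides the falling factorial `m(m−1)⋯(m−s+1)`. -/
theorem sum_eval_iterate_derivative_X_pow (p : ℕ) [hp : Fact p.Prime] (s m : ℕ)
    (hm : m < s + (s + 1) * (p - 1)) :
    ∑ x : ZMod p, ((derivative^[s]) ((X : (ZMod p)[X]) ^ m)).eval x = 0 := by
  classical
  have hp2 : 2 ≤ p := hp.out.two_le
  rw [Polynomial.iterate_derivative_X_pow_eq_natCast_mul]
  simp only [eval_mul, eval_natCast, eval_pow, eval_X, ← Finset.mul_sum]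
  by_cases hms : m - s = 0
  · have : ∑ x : ZMod p, x ^ (m - s) = 0 := by
      simp [hms]
    rw [this, mul_zero]
  · rw [sum_pow_zmod_eq p (m - s) hms]
    split_ifs with hdvd
    · obtain ⟨l, hl⟩ := hdvd
      -- hl : m - s = (p - 1) * l
      have hge : s ≤ m := by
        by_contra hcon
        apply hms; omega
      have h1 : m = s + (p - 1) * l := by omega
      have hl1 : 1 ≤ l := by
        rcases Nat.eq_zero_or_pos l with h0 | h0
        · exfalso; apply hms; rw [hl, h0, mul_zero]
        · exact h0
      have hls : l ≤ s := by
        have hlt : (p - 1) * l < (p - 1) * (s + 1) := by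
          have : (s + 1) * (p - 1) = (p - 1) * (s + 1) := Nat.mul_comm _ _
          omega
        have := Nat.lt_of_mul_lt_mul_left hlt
        omega
      -- the factor m - (s - l) = p * l occurs in the falling factorial
      have hp1 : p - 1 + 1 = p := Nat.sub_add_cancel hp.out.one_le
      have h3 : (p - 1 + 1) * l = (p - 1) * l + l := by rw [Nat.add_mul, one_mul]
      rw [hp1] at h3
      have hfac : m - (s - l) = p * l := by omega
      have hdv : p ∣ m - (s - l) := by rw [hfac]; exact dvd_mul_right p l
      have hdvd' : p ∣ m.descFactorial s := by
        rw [Nat.descFactorial_eq_prod_range]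
        have hmem : s - l ∈ range s := by rw [mem_range]; omega
        exact hdv.trans (Finset.dvd_prod_of_mem (fun i => m - i) hmem)
      have hz : ((m.descFactorial s : ℕ) : ZMod p) = 0 := (ZMod.natCast_eq_zero_iff _ _).mpr hdvd'
      rw [hz, zero_mul]
    · rw [mul_zero]

/-- The power-sum lemma in derivative form: for every `P ∈ 𝔽_p[X]` with `deg P < s + (s+1)(p−1)`,
`Σ_{x ∈ 𝔽_p} P^{(s)}(x) = 0`. -/
theorem sum_eval_iterate_derivative_eq_zero (p : ℕ) [hp : Fact p.Prime] (s : ℕ) (P : (ZMod p)[X])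
    (hP : P.natDegree < s + (s + 1) * (p - 1)) :
    ∑ x : ZMod p, ((derivative^[s]) P).eval x = 0 := by
  classical
  have hrepr : (derivative^[s]) P =
      ∑ i ∈ range (P.natDegree + 1), C (P.coeff i) * (derivative^[s]) ((X : (ZMod p)[X]) ^ i) := by
    conv_lhs => rw [P.as_sum_range_C_mul_X_pow]
    rw [iterate_derivative_sum]
    refine Finset.sum_congr rfl fun i _ => ?_
    rw [iterate_derivative_C_mul]
  rw [hrepr]
  simp only [eval_finsetSum, eval_mul, eval_C]
  rw [Finset.sum_comm]
  refine Finset.sum_eq_zero fun i hi => ?_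
  have hi' : i < s + (s + 1) * (p - 1) :=
    lt_of_le_of_lt (Nat.lt_succ_iff.mp (mem_range.mp hi)) hP
  rw [← Finset.mul_sum, sum_eval_iterate_derivative_X_pow p s i hi', mul_zero]

/-- `∏_{a ∈ 𝔽_p} (X − a) = X^p − X`. -/
theorem prod_X_sub_C_eq (p : ℕ) [hp : Fact p.Prime] :
    ∏ a : ZMod p, (X - C a) = X ^ p - X := by
  classical
  have hq1 : 1 < Fintype.card (ZMod p) := Fintype.one_lt_card
  have hmonic : (X ^ Fintype.card (ZMod p) - X : (ZMod p)[X]).Monic :=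
    monic_X_pow_sub (by rw [degree_X]; exact_mod_cast hq1)
  have hroots : (X ^ Fintype.card (ZMod p) - X : (ZMod p)[X]).roots = (univ : Finset (ZMod p)).val :=
    FiniteField.roots_X_pow_card_sub_X (ZMod p)
  have hcard : Multiset.card (X ^ Fintype.card (ZMod p) - X : (ZMod p)[X]).roots
      = (X ^ Fintype.card (ZMod p) - X : (ZMod p)[X]).natDegree := by
    rw [hroots, FiniteField.X_pow_card_sub_X_natDegree_eq (ZMod p) hq1]
    rfl
  have h := prod_multiset_X_sub_C_of_monic_of_roots_card_eq hmonic hcard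
  rw [hroots] at h
  have h' : ∏ a : ZMod p, (X - C a) = X ^ Fintype.card (ZMod p) - X := by
    rw [Finset.prod_eq_multiset_prod]; exact h
  rw [h', ZMod.card p]

/-- Wilson's theorem in polynomial form: `∏_{a ∈ 𝔽_p, a ≠ 0} (X + a) = X^{p−1} − 1`. -/
theorem prod_X_add_C_erase_zero_eq (p : ℕ) [hp : Fact p.Prime] :
    ∏ a ∈ (univ : Finset (ZMod p)).erase 0, (X + C a) = X ^ (p - 1) - 1 := by
  classical
  -- reflect a ↦ −a in the full product
  have hfull : ∏ a : ZMod p, (X + C a) = X ^ p - X := by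
    rw [← prod_X_sub_C_eq p]
    exact Fintype.prod_equiv (Equiv.neg (ZMod p)) _ _ fun a => by simp
  have hsplit : ∏ a : ZMod p, (X + C a) = X * ∏ a ∈ (univ : Finset (ZMod p)).erase 0, (X + C a) := by
    rw [← Finset.mul_prod_erase univ (fun a : ZMod p => X + C a) (mem_univ 0)]
    simp
  have hp1 : p - 1 + 1 = p := Nat.sub_add_cancel hp.out.one_le
  have hX : (X : (ZMod p)[X]) * (X ^ (p - 1) - 1) = X ^ p - X := by
    rw [mul_sub, mul_one, ← pow_succ', hp1]
  have hmain : (X : (ZMod p)[X]) * ∏ a ∈ (univ : Finset (ZMod p)).erase 0, (X + C a)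
      = X * (X ^ (p - 1) - 1) := by
    rw [← hsplit, hfull, hX]
  exact mul_left_cancel₀ X_ne_zero hmain

end Summit.KontsevichZagierPeriods.Zeta5Search.ExcessWindow
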